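import Summits.QuantumFields.YangMills.Theorems.BalabanLadderNTStrongCouplingTriple
import Summits.QuantumFields.YangMills.Theorems.BalabanLadderNTReferenceTorusTwoPoint
import Summits.QuantumFields.YangMills.Theorems.BalabanLadderNTReferenceTransferCumulant
import Summits.QuantumFields.YangMills.Theorems.BalabanLadderNTBoundaryLawReferenceValue
import HarnessLib

/-!
# Crux `NT` (stmt-QuantumFields-19353) / seam `UVSeamRec` (stmt-QuantumFields-20043): the torus-to-torus TRANSFER fed with real
# inputs — exponential volume-Cauchy estimates for the torus 1-, 2-, 3-point functions of the action density at strong coupling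

Helper file of the fleet lead prover of crux `NT` (unit `ym-spine-19353-p1`, g6).  The composition `NT_of` of the registered
skeleton v4T runs the torus-to-torus transfer lemmas of the line (`Reference.abs_torusCov_dens_sub_torusCov_dens_le`,
`Reference.abs_torusK3_sub_torusK3_le`, `BoundaryLaw.abs_torusE_sub_le_of_kernel`) on the three exterior-oscillation ceilings
E1/E2/E3-osc of `RefPkgT`.  Every file of the chain so far fed those lemmas HYPOTHESES.  Here they are fed the strong-coupling
THEOREMS of the sibling files (`osc_kerE_dens_le_smallBeta_dobrushin`, `osc_kerCov_dens_le_depth_smallBeta`,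
`osc_kerK3_le_depth_smallBeta`), which yields UNCONDITIONAL statements about Wilson's lattice Yang–Mills measure on the tori
`(ℤ/(2L+1))⁴` at `216 · N · |β| ≤ 1`, every compact metrisable `G`, every lattice representation `r`:

* `torusE_dens_cauchy_smallBeta` — `|torusE_L(dens x) − torusE_{L'}(dens x)| ≤ 16 M S · 2^{−(R+1)}` whenever `1 ≤ R`,
  `R + 1 ≤ L, L'` (the one-point function is Cauchy in the volume at rate `2^{−min(L,L')}`: `torusE_dens_cauchy_min`);
* `torusCov_dens_cauchy_smallBeta` — for a transfer cube `(c₀, b₀)` fitting in both tori (`b₀ + 3 ≤ 2L+1, 2L'+1`) and sites `x, y`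
  of depth `≥ 1` in it: `|torusCov_L(dens x, dens y) − torusCov_{L'}(dens x, dens y)| ≤ (128 M² S² + 32 M² S) · 2^{−min depth}`;
* `torusK3_cauchy_smallBeta` — likewise for the third cumulant: `≤ (1536 M³ S² + 1024 M³ S³ + 144 M³ S) · 2^{−min depth}`.

So the torus `n`-point functions (`n ≤ 3`) of `tr_r F²` converge exponentially fast in the volume at high temperature — the
transfer plumbing of the NT line is non-vacuous, and its output at strong coupling is the (known) thermodynamic limit.
HONEST FRAMING: high temperature only; nothing about `β → ∞`, the floors, NT, the seam or the gap.

References: Georgii 2011 Def. 1.23, Thm. 8.20; Dobrushin 1970; Osterwalder–Seiler 1978 §4 (strong-coupling cluster properties).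
-/

set_option autoImplicit false

noncomputable section

open MeasureTheory Filter Topology
open Literature.MathematicalPhysics.QuantumFieldTheory Literature.MathematicalPhysics.QuantumLattice
open Literature.Probability.LatticeModels
open Summit.QuantumFields.YangMills.Cruxes.OSLegsFromFemtoAndGap.DlrCollarTransfer
open Summit.QuantumFields.YangMills.Cruxes.OSLegsFromFemtoAndGap.DlrCollarTransfer.StubLower (dens_supp_window isCylinder_dens)

namespace Summit.QuantumFields.YangMills.Cruxes.NT.StrongCoupling

section Main

variable (G : Type) [Group G] [TopologicalSpace G] [IsTopologicalGroup G] [CompactSpace G]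
  [MeasurableSpace G] [BorelSpace G] (r : LatticeRep G)

/-- **One-point function: Cauchy in the volume at strong coupling.**  For `216 N |β| ≤ 1`, every site `x`, every radius
`R ≥ 1` and all tori `2L+1`, `2L'+1` with `R + 1 ≤ L, L'`:
`|torusE_L(dens x) − torusE_{L'}(dens x)| ≤ 16 M S · 2^{−(R+1)}` — both torus means are within `8 M S 2^{−(R+1)}` of the kernel
mean of the cube of radius `R` around `x` with ANY fixed exterior (`BoundaryLaw.abs_torusE_sub_le_of_kernel` +
`osc_kerE_dens_le_smallBeta_dobrushin`, the centre having depth `R + 1`). [folklore] -/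
theorem torusE_dens_cauchy_smallBeta {β : ℝ} (hβ : 216 * (r.N : ℝ) * |β| ≤ 1) {M : ℝ}
    (hM : ∀ (w : Fin 4 → ℤ) (U : LGConfig 4 G), |dens G r w U| ≤ M) (x : Fin 4 → ℤ) {R L L' : ℕ} (hR : 1 ≤ R)
    (hL : R + 1 ≤ L) (hL' : R + 1 ≤ L') :
    |torusE G r β L (dens G r x) - torusE G r β L' (dens G r x)| ≤
      16 * M * r.curvature.supp.card * (1 / 2 : ℝ) ^ (R + 1) := by
  set η₀ : LGConfig 4 G := fun _ => 1
  set p : ℝ := kerE G r β (fun j => x j - R) (2 * R + 1) η₀ (dens G r x)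
  have hdepth := BoundaryLaw.succ_le_depth_centre x R
  have hker : ∀ η, |kerE G r β (fun j => x j - R) (2 * R + 1) η (dens G r x) - p| ≤
      8 * M * r.curvature.supp.card * (1 / 2 : ℝ) ^ (R + 1) := fun η =>
    (osc_kerE_dens_le_smallBeta_dobrushin G r hβ hM _ _ η η₀ x).trans
      (mul_le_mul_of_nonneg_left (pow_le_pow_of_le_one (by norm_num) (by norm_num) hdepth)
        (by have hM0 : 0 ≤ M := (abs_nonneg _).trans (hM 0 fun _ => 1); positivity))
  have hS₀ := dens_supp_window G r x x R (fun j => by simp; exact_mod_cast hR)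
  have h1 := BoundaryLaw.abs_torusE_sub_le_of_kernel G r β x R L hL (continuous_dens r x) (hM x) (isCylinder_dens G r x) hS₀ hker
  have h2 := BoundaryLaw.abs_torusE_sub_le_of_kernel G r β x R L' hL' (continuous_dens r x) (hM x) (isCylinder_dens G r x) hS₀ hker
  rw [abs_sub_le_iff] at h1 h2
  rw [abs_le]
  constructor <;> linarith [h1.1, h1.2, h2.1, h2.2]

/-- **One-point function: rate `2^{−min(L, L')}`** (`R = min(L, L') − 1`). [folklore] -/
theorem torusE_dens_cauchy_min {β : ℝ} (hβ : 216 * (r.N : ℝ) * |β| ≤ 1) {M : ℝ}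
    (hM : ∀ (w : Fin 4 → ℤ) (U : LGConfig 4 G), |dens G r w U| ≤ M) (x : Fin 4 → ℤ) {L L' : ℕ} (hL : 2 ≤ L)
    (hL' : 2 ≤ L') :
    |torusE G r β L (dens G r x) - torusE G r β L' (dens G r x)| ≤
      16 * M * r.curvature.supp.card * (1 / 2 : ℝ) ^ min L L' := by
  have h := torusE_dens_cauchy_smallBeta G r hβ hM x (R := min L L' - 1) (L := L) (L' := L') (by omega)
    (by have := min_le_left L L'; omega) (by have := min_le_right L L'; omega)
  have e : min L L' - 1 + 1 = min L L' := by omega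
  rwa [e] at h

/-- **Two-point function: Cauchy in the volume at strong coupling.**  For `216 N |β| ≤ 1`, a transfer cube `(c₀, b₀)`
fitting in both tori (`b₀ + 3 ≤ 2L+1`, `b₀ + 3 ≤ 2L'+1`) and sites `x, y` of depth `≥ 1` in it:
`|torusCov_L(dens x, dens y) − torusCov_{L'}(dens x, dens y)| ≤ (128 M² S² + 32 M² S) · 2^{−min(depth x, depth y)}`
(`Reference.abs_torusCov_dens_sub_torusCov_dens_le` fed with `osc_kerE_dens_le_smallBeta_dobrushin` and
`osc_kerCov_dens_le_depth_smallBeta`). [folklore] -/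
theorem torusCov_dens_cauchy_smallBeta {β : ℝ} (hβ : 216 * (r.N : ℝ) * |β| ≤ 1) {M : ℝ}
    (hM : ∀ (w : Fin 4 → ℤ) (U : LGConfig 4 G), |dens G r w U| ≤ M) (c₀ : Fin 4 → ℤ) (b₀ : ℕ) {L L' : ℕ}
    (hL : b₀ + 3 ≤ 2 * L + 1) (hL' : b₀ + 3 ≤ 2 * L' + 1) {x y : Fin 4 → ℤ} (hx : 1 ≤ depth c₀ b₀ x)
    (hy : 1 ≤ depth c₀ b₀ y) :
    |(torusE G r β L (fun U => dens G r x U * dens G r y U) - torusE G r β L (dens G r x) * torusE G r β L (dens G r y))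
      - (torusE G r β L' (fun U => dens G r x U * dens G r y U) -
          torusE G r β L' (dens G r x) * torusE G r β L' (dens G r y))| ≤
      (128 * M ^ 2 * r.curvature.supp.card ^ 2 + 32 * M ^ 2 * r.curvature.supp.card) *
        (1 / 2 : ℝ) ^ min (depth c₀ b₀ x) (depth c₀ b₀ y) := by
  have hM0 : 0 ≤ M := (abs_nonneg _).trans (hM 0 fun _ => 1)
  have hS0 : (0 : ℝ) ≤ (r.curvature.supp.card : ℝ) := by positivity
  have hP0 : (0 : ℝ) ≤ (1 / 2 : ℝ) ^ min (depth c₀ b₀ x) (depth c₀ b₀ y) := by positivity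
  have hP1 : (1 / 2 : ℝ) ^ min (depth c₀ b₀ x) (depth c₀ b₀ y) ≤ 1 := pow_le_one₀ (by norm_num) (by norm_num)
  have hpx : (1 / 2 : ℝ) ^ depth c₀ b₀ x ≤ (1 / 2 : ℝ) ^ min (depth c₀ b₀ x) (depth c₀ b₀ y) :=
    pow_le_pow_of_le_one (by norm_num) (by norm_num) (min_le_left _ _)
  have hpy : (1 / 2 : ℝ) ^ depth c₀ b₀ y ≤ (1 / 2 : ℝ) ^ min (depth c₀ b₀ x) (depth c₀ b₀ y) :=
    pow_le_pow_of_le_one (by norm_num) (by norm_num) (min_le_right _ _)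
  have hox : ∀ ζ ζ', |kerE G r β c₀ b₀ ζ (dens G r x) - kerE G r β c₀ b₀ ζ' (dens G r x)| ≤
      8 * M * r.curvature.supp.card * (1 / 2 : ℝ) ^ min (depth c₀ b₀ x) (depth c₀ b₀ y) :=
    fun ζ ζ' => (osc_kerE_dens_le_smallBeta_dobrushin G r hβ hM c₀ b₀ ζ ζ' x).trans
      (mul_le_mul_of_nonneg_left hpx (by positivity))
  have hoy : ∀ ζ ζ', |kerE G r β c₀ b₀ ζ (dens G r y) - kerE G r β c₀ b₀ ζ' (dens G r y)| ≤
      8 * M * r.curvature.supp.card * (1 / 2 : ℝ) ^ min (depth c₀ b₀ x) (depth c₀ b₀ y) :=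
    fun ζ ζ' => (osc_kerE_dens_le_smallBeta_dobrushin G r hβ hM c₀ b₀ ζ ζ' y).trans
      (mul_le_mul_of_nonneg_left hpy (by positivity))
  have hoC : ∀ ζ ζ', |kerCov G r β c₀ b₀ ζ (dens G r x) (dens G r y) - kerCov G r β c₀ b₀ ζ' (dens G r x) (dens G r y)| ≤
      32 * M ^ 2 * r.curvature.supp.card * (1 / 2 : ℝ) ^ min (depth c₀ b₀ x) (depth c₀ b₀ y) :=
    fun ζ ζ' => osc_kerCov_dens_le_depth_smallBeta G r hβ hM c₀ b₀ ζ ζ' x y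
  refine (Reference.abs_torusCov_dens_sub_torusCov_dens_le G r β c₀ b₀ L L' hL hL' hx hy hox hoy hoC).trans ?_
  -- pure arithmetic from here on: abbreviate the card and the decay factor
  generalize (r.curvature.supp.card : ℝ) = S at hS0 ⊢
  generalize (1 / 2 : ℝ) ^ min (depth c₀ b₀ x) (depth c₀ b₀ y) = P at hP0 hP1 ⊢
  have hPP : P * P ≤ P := by nlinarith
  have hMS : 0 ≤ M * M * (S * S) := by positivity
  calc _ = 128 * (M * M * (S * S)) * (P * P) + 32 * M ^ 2 * S * P := by ring
    _ ≤ 128 * (M * M * (S * S)) * P + 32 * M ^ 2 * S * P := by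
        have := mul_le_mul_of_nonneg_left hPP hMS; linarith
    _ = (128 * M ^ 2 * S ^ 2 + 32 * M ^ 2 * S) * P := by ring

/-- **Third cumulant: Cauchy in the volume at strong coupling.**  For `216 N |β| ≤ 1`, a transfer cube `(c₀, b₀)` fitting in
both tori and sites `x, y, z` of depth `≥ 1` in it:
`|torusK3_L(x,y,z) − torusK3_{L'}(x,y,z)| ≤ (1536 M³ S² + 1024 M³ S³ + 144 M³ S) · 2^{−min depth}`
(`Reference.abs_torusK3_sub_torusK3_le` fed with the three strong-coupling ceilings). [folklore] -/
theorem torusK3_cauchy_smallBeta {β : ℝ} (hβ : 216 * (r.N : ℝ) * |β| ≤ 1) {M : ℝ}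
    (hM : ∀ (w : Fin 4 → ℤ) (U : LGConfig 4 G), |dens G r w U| ≤ M) (c₀ : Fin 4 → ℤ) (b₀ : ℕ) {L L' : ℕ}
    (hL : b₀ + 3 ≤ 2 * L + 1) (hL' : b₀ + 3 ≤ 2 * L' + 1) {x y z : Fin 4 → ℤ} (hx : 1 ≤ depth c₀ b₀ x)
    (hy : 1 ≤ depth c₀ b₀ y) (hz : 1 ≤ depth c₀ b₀ z) :
    |torusK3 G r β L x y z - torusK3 G r β L' x y z| ≤
      (1536 * M ^ 3 * r.curvature.supp.card ^ 2 + 1024 * M ^ 3 * r.curvature.supp.card ^ 3 +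
          144 * M ^ 3 * r.curvature.supp.card) *
        (1 / 2 : ℝ) ^ min (min (depth c₀ b₀ x) (depth c₀ b₀ y)) (depth c₀ b₀ z) := by
  have hM0 : 0 ≤ M := (abs_nonneg _).trans (hM 0 fun _ => 1)
  have hS0 : (0 : ℝ) ≤ (r.curvature.supp.card : ℝ) := by positivity
  have hP0 : (0 : ℝ) ≤ (1 / 2 : ℝ) ^ min (min (depth c₀ b₀ x) (depth c₀ b₀ y)) (depth c₀ b₀ z) := by positivity
  have hP1 : (1 / 2 : ℝ) ^ min (min (depth c₀ b₀ x) (depth c₀ b₀ y)) (depth c₀ b₀ z) ≤ 1 :=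
    pow_le_one₀ (by norm_num) (by norm_num)
  have hle : ∀ {n : ℕ}, min (min (depth c₀ b₀ x) (depth c₀ b₀ y)) (depth c₀ b₀ z) ≤ n →
      (1 / 2 : ℝ) ^ n ≤ (1 / 2 : ℝ) ^ min (min (depth c₀ b₀ x) (depth c₀ b₀ y)) (depth c₀ b₀ z) := fun h =>
    pow_le_pow_of_le_one (by norm_num) (by norm_num) h
  have hx' : min (min (depth c₀ b₀ x) (depth c₀ b₀ y)) (depth c₀ b₀ z) ≤ depth c₀ b₀ x :=
    (min_le_left _ _).trans (min_le_left _ _)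
  have hy' : min (min (depth c₀ b₀ x) (depth c₀ b₀ y)) (depth c₀ b₀ z) ≤ depth c₀ b₀ y :=
    (min_le_left _ _).trans (min_le_right _ _)
  have hz' : min (min (depth c₀ b₀ x) (depth c₀ b₀ y)) (depth c₀ b₀ z) ≤ depth c₀ b₀ z := min_le_right _ _
  have hk : ∀ {u : Fin 4 → ℤ}, min (min (depth c₀ b₀ x) (depth c₀ b₀ y)) (depth c₀ b₀ z) ≤ depth c₀ b₀ u → ∀ ζ ζ',
      |kerE G r β c₀ b₀ ζ (dens G r u) - kerE G r β c₀ b₀ ζ' (dens G r u)| ≤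
        8 * M * r.curvature.supp.card * (1 / 2 : ℝ) ^ min (min (depth c₀ b₀ x) (depth c₀ b₀ y)) (depth c₀ b₀ z) :=
    fun hu ζ ζ' => (osc_kerE_dens_le_smallBeta_dobrushin G r hβ hM c₀ b₀ ζ ζ' _).trans
      (mul_le_mul_of_nonneg_left (hle hu) (by positivity))
  have hw : ∀ {u v : Fin 4 → ℤ}, min (min (depth c₀ b₀ x) (depth c₀ b₀ y)) (depth c₀ b₀ z) ≤ depth c₀ b₀ u →
      min (min (depth c₀ b₀ x) (depth c₀ b₀ y)) (depth c₀ b₀ z) ≤ depth c₀ b₀ v → ∀ ζ ζ',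
      |kerCov G r β c₀ b₀ ζ (dens G r u) (dens G r v) - kerCov G r β c₀ b₀ ζ' (dens G r u) (dens G r v)| ≤
        32 * M ^ 2 * r.curvature.supp.card * (1 / 2 : ℝ) ^ min (min (depth c₀ b₀ x) (depth c₀ b₀ y)) (depth c₀ b₀ z) :=
    fun hu hv ζ ζ' => (osc_kerCov_dens_le_depth_smallBeta G r hβ hM c₀ b₀ ζ ζ' _ _).trans
      (mul_le_mul_of_nonneg_left (hle (le_min hu hv)) (by positivity))
  have ho3 : ∀ ζ ζ', |kerK3 G r β c₀ b₀ ζ x y z - kerK3 G r β c₀ b₀ ζ' x y z| ≤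
      144 * M ^ 3 * r.curvature.supp.card * (1 / 2 : ℝ) ^ min (min (depth c₀ b₀ x) (depth c₀ b₀ y)) (depth c₀ b₀ z) :=
    fun ζ ζ' => osc_kerK3_le_depth_smallBeta G r hβ hM c₀ b₀ ζ ζ' x y z
  refine (Reference.abs_torusK3_sub_torusK3_le G r β c₀ b₀ L L' hL hL' hx hy hz (hk hx') (hk hy') (hk hz') (hw hy' hz')
    (hw hx' hz') (hw hx' hy') ho3).trans ?_
  -- pure arithmetic from here on
  generalize (r.curvature.supp.card : ℝ) = S at hS0 ⊢
  generalize (1 / 2 : ℝ) ^ min (min (depth c₀ b₀ x) (depth c₀ b₀ y)) (depth c₀ b₀ z) = P at hP0 hP1 ⊢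
  have hPP : P * P ≤ P := by nlinarith
  have hPPP : P * P * P ≤ P := by nlinarith
  have hA : 0 ≤ M * (M * M) * (S * S) := by positivity
  have hB : 0 ≤ M * (M * M) * (S * (S * S)) := by positivity
  calc _ = 1536 * (M * (M * M) * (S * S)) * (P * P) + 1024 * (M * (M * M) * (S * (S * S))) * (P * P * P) +
          144 * M ^ 3 * S * P := by ring
    _ ≤ 1536 * (M * (M * M) * (S * S)) * P + 1024 * (M * (M * M) * (S * (S * S))) * P + 144 * M ^ 3 * S * P := by
        have t1 := mul_le_mul_of_nonneg_left hPP hA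
        have t2 := mul_le_mul_of_nonneg_left hPPP hB
        linarith
    _ = (1536 * M ^ 3 * S ^ 2 + 1024 * M ^ 3 * S ^ 3 + 144 * M ^ 3 * S) * P := by ring

end Main

end Summit.QuantumFields.YangMills.Cruxes.NT.StrongCoupling

end
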